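import Mathlib
import Summits.ResolutionOfSingularities.ResolutionOfSingularities.Theorems.RadicialJungCleanModelsCleanLU3Defectless
import HarnessLib

/-!
# Route `RadicialJung`, crux `CleanModels` (stmt-15917), stub `stub_cleanLU3DefectNonDiscrete`, sub-line (C): the RAMIFIED branch along a
# coarsening is the defectless half — Step 1 (e) of the lead's memo `Cruxes/CleanModels/Lines/Sketch-memo-nondiscrete-classC.md`

Line `Sketch` rev 24 of crux stmt-ResolutionOfSingularities-15917; lead `res-B-lead-1` g3.  OURS; nothing here proves resolution in
characteristic `p`.  Let `O ≤ O₁` be valuation rings of `K` (`O₁` a COARSENING of `O`: composite valuation `v = v₁ ∘ v₂`).  If the remainder `g₀ - a^p` is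
RAMIFIED for the coarse valuation (`v₁(g₀ - a^p)` is not the `v₁`-value of a `p`-th power — one branch of ✓ `bestApprox_dichotomy` at the best
`v₁`-approximation that ✓ `exists_best_pthPowerApprox_of_derivation` provides along a divisorial `v₁`), then `a` is a best approximation for the
fine valuation `v` — because `g₀ - b^p = (g₀ - a^p) + (a - b)^p` has two summands of DIFFERENT `v₁`-value, and a strict
`v₁`-inequality is a strict `v`-inequality — so the landed defectless half ✓ `cleanLU3_of_isMin_pthPowerApprox` (modulo CJS Cor. 1.5, `hEmb`)
closes the branch: NO residue-surface descent is needed there.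

* `valuation_lt_of_le_of_valuation_lt` — `O ≤ O₁`, `v₁ x < v₁ y ⟹ v x < v y`.
* `isMin_of_ramified_coarse` — ramified for `v₁` ⟹ best for `v` (no bestness hypothesis is even needed).
* `cleanLU3_of_bestCoarseApprox_ramified` — the branch (e) of the (C) sub-line, verbatim conclusion of the stub.
-/

noncomputable section

set_option linter.dupNamespace false -- mandated namespace of this single-conjunct summit

open IsLocalRing AlgebraicGeometry CategoryTheory
open Literature.AlgebraicGeometry.Resolution

namespace Summit.ResolutionOfSingularities.ResolutionOfSingularities.Theorems.RadicialJung.CleanModels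

variable {K : Type} [Field K]

/-- **Strict inequalities pass from a coarsening to the fine valuation**: for valuation rings `O ≤ O₁` of `K`,
`v₁ x < v₁ y ⟹ v x < v y` (the map of value groups `Γ_O → Γ_{O₁}` is monotone). [folklore] -/
theorem valuation_lt_of_le_of_valuation_lt (O O₁ : ValuationSubring K) (h : O ≤ O₁) {x y : K}
    (hlt : O₁.valuation x < O₁.valuation y) : O.valuation x < O.valuation y := by
  by_contra hle
  push Not at hle
  have hmono := ValuationSubring.monotone_mapOfLE O O₁ h hle
  rw [ValuationSubring.mapOfLE_valuation_apply, ValuationSubring.mapOfLE_valuation_apply] at hmono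
  exact absurd hmono (not_le.mpr hlt)

/-- **Ramified for a coarsening ⟹ best for the fine valuation** (characteristic `p`): if `v₁ (g₀ - a^p)` is not the `v₁`-value of a `p`-th
power, then `a` is a best `p`-th-power approximation of `g₀` for every valuation ring `O ≤ O₁` (and in particular for `O₁`): the two summands of
`g₀ - b^p = (g₀ - a^p) + (a - b)^p` have different `v₁`-values. [folklore] -/
theorem isMin_of_ramified_coarse (p : ℕ) [hp : Fact p.Prime] [CharP K p] (O O₁ : ValuationSubring K) (h : O ≤ O₁)
    (g₀ a : K) (hram : ∀ c : K, O₁.valuation (c ^ p) ≠ O₁.valuation (g₀ - a ^ p)) :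
    ∀ b : K, O.valuation (g₀ - a ^ p) ≤ O.valuation (g₀ - b ^ p) := by
  intro b
  have hexp : g₀ - b ^ p = (g₀ - a ^ p) + (a - b) ^ p := by rw [sub_pow_char]; ring
  rcases lt_or_gt_of_ne (hram (a - b)) with hlt | hgt
  · -- `(a - b)^p` is `v₁`-deeper than `g₀ - a^p`: the sum has the `v`-value of `g₀ - a^p`
    have hlt' := valuation_lt_of_le_of_valuation_lt O O₁ h hlt
    rw [hexp, Valuation.map_add_eq_of_lt_left _ hlt']
  · -- `g₀ - a^p` is `v₁`-deeper than `(a - b)^p`: then `b` is even `v₁`-worse, contradicting nothing — `v (g₀ - b^p) = v ((a-b)^p) > v (g₀ - a^p)`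
    have hgt' := valuation_lt_of_le_of_valuation_lt O O₁ h hgt
    rw [hexp, Valuation.map_add_eq_of_lt_right _ hgt']
    exact hgt'.le

/-- **Branch (e) of the composite sub-line**: at a zero-dimensional valuation ring `O` with a 3-dimensional regular centre, if along some
COARSENING `O₁ ≥ O` some `p`-th-power approximation `a` of the non-`p`-th power `g₀` has a remainder RAMIFIED for `v₁`, then clean local
uniformization of the `K^p`-line of `g₀` holds at `O` — modulo embedded resolution of surfaces (`hEmb`, CJS 2020 Cor. 1.5), by the landed
defectless half ✓ `cleanLU3_of_isMin_pthPowerApprox`. [cite: CossartJannsenSaito2020, Cor. 1.5, p. 7] -/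
theorem cleanLU3_of_bestCoarseApprox_ramified
    (hEmb : ∀ (Z : Scheme.{0}) [IsIntegral Z] [IsNoetherian Z], Scheme.IsRegular Z →
      Scheme.IsExcellent Z → ∀ (X : Set Z), IsClosed X → X ≠ Set.univ → topologicalKrullDim X ≤ 2 →
        ∃ (Z' : Scheme.{0}) (π : Z' ⟶ Z), IsProper π ∧ Function.Surjective π.base ∧
          (∃ U : Z.Opens, (U : Set Z) = Xᶜ ∧ IsIso (π ∣_ U)) ∧
          IsStrictNormalCrossingsDivisor Z' (π.base ⁻¹' X))
    (p : ℕ) (hp : p.Prime) (k : Type) [Field k] [CharP k p] (K : Type) [Field K] [Algebra k K]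
    (O : ValuationSubring K) (A : Subalgebra k K) (hAO : A.toSubring ≤ O.toSubring) (hAfg : A.FG)
    (hfrac : IsFractionRing A K)
    (hreg : IsRegularLocalRing (locAtCentre A.toSubring O))
    (hdim3 : ringKrullDim (locAtCentre A.toSubring O) = 3)
    (g₀ : K) (hg₀ : ∀ c : K, c ^ p ≠ g₀)
    (O₁ : ValuationSubring K) (hO₁ : O ≤ O₁) (a : K)
    (hram : ∀ c : K, O₁.valuation (c ^ p) ≠ O₁.valuation (g₀ - a ^ p)) :
    ∃ (A' : Subalgebra k K), A'.toSubring ≤ O.toSubring ∧ A ≤ A' ∧ A'.FG ∧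
      ∃ (_ : IsRegularLocalRing (locAtCentre A'.toSubring O)) (c : Fin p → K),
        (∃ j : Fin p, (j : ℕ) ≠ 0 ∧ c j ≠ 0) ∧
        ((∃ (d m : ℕ) (hmd : m ≤ d) (t : Fin d → ↥(locAtCentre A'.toSubring O)) (a : Fin m → ℕ)
            (u : ↥(locAtCentre A'.toSubring O)), IsUnit u ∧
            Ideal.span (Set.range t) = IsLocalRing.maximalIdeal ↥(locAtCentre A'.toSubring O) ∧
            ringKrullDim ↥(locAtCentre A'.toSubring O) = (d : WithBot ℕ∞) ∧ 0 < m ∧ (∀ i, ¬ p ∣ a i) ∧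
            (∑ j : Fin p, c j ^ p * g₀ ^ (j : ℕ)) =
              (u : K) * ∏ i : Fin m, ((t (Fin.castLE hmd i) : ↥(locAtCentre A'.toSubring O)) : K) ^ (a i)) ∨
          (∃ u : ↥(locAtCentre A'.toSubring O), IsUnit u ∧ (∑ j : Fin p, c j ^ p * g₀ ^ (j : ℕ)) = (u : K) ∧
            ∀ c' : ↥(locAtCentre A'.toSubring O), u - c' ^ p ∉ IsLocalRing.maximalIdeal ↥(locAtCentre A'.toSubring O)) ∨
          (∃ s c' : ↥(locAtCentre A'.toSubring O), (∑ j : Fin p, c j ^ p * g₀ ^ (j : ℕ)) = (s : K) ∧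
            s - c' ^ p ∈ IsLocalRing.maximalIdeal ↥(locAtCentre A'.toSubring O) ∧
            s - c' ^ p ∉ IsLocalRing.maximalIdeal ↥(locAtCentre A'.toSubring O) ^ 2)) := by
  haveI : Fact p.Prime := ⟨hp⟩
  haveI : CharP K p := charP_of_injective_algebraMap (algebraMap k K).injective p
  exact cleanLU3_of_isMin_pthPowerApprox hEmb p hp k K O A hAO hAfg hfrac hreg hdim3 g₀ hg₀ a
    (isMin_of_ramified_coarse p O O₁ hO₁ g₀ a hram)

end Summit.ResolutionOfSingularities.ResolutionOfSingularities.Theorems.RadicialJung.CleanModels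

end
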